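import Mathlib
import HarnessLib
import Literature.Combinatorics.Additive.StepBeyondKempermanReduction

/-!
# Grynkiewicz 2009, §6 Claim 5, case `l = 4`: the Klein group `K = H × H′` and display (42)

[cite: Grynkiewicz2009, §6 Claim 5 (proof of Thm 4.1, p. 25, case l = 4), display (42)] [tag: critical-pair] [tag: inverse-theorem]

Topic `Literature/Combinatorics/Additive`.  Cell `mm-stpp` (D-0046), seat `mm-stpp-lit` (gen 23); the
port of D. J. Grynkiewicz, *A step beyond Kemperman's structure theorem*, Mathematika **55** (2009)
67–114 continued.  §6 Claim 5, case `l = 4` (print p. 25), in the frame delivered by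
`seventeen_or_fourPairs` (`StepBeyondKempermanTwoHolesReduction.lean`): «Let `A + B = C`.  Hence, since
each `C_{γᵢ}` is a partially filled `H`-coset with `|H| = 2`, it follows in view of `l = 4` that
`C_{γ₁} ∪ C_{γ₂} = (A_{a₁} ∪ A_{a₂}) + (B_{b₁} ∪ B_{b₂}) = b₁ + (A_{a₁} ∪ A_{a₂}) = a₁ + (B_{b₁} ∪ B_{b₂})`,
implying from Kneser's Theorem that `(A_{a₁} ∪ A_{a₂}) + (B_{b₁} ∪ B_{b₂})` is periodic with maximal
period (say) `H′`.  Since `|B_{b₁} ∪ B_{b₂}| = 2`, it follows that `|H′| = 2`.  Let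
`K = H × H′ ≅ ℤ/2ℤ × ℤ/2ℤ`.  Since `C_{γ₁} ∪ C_{γ₂}` is an `H′`-coset, it follows that it does not contain
an `H`-coset.  Hence `φ_K(γ₁) = φ_K(a₁) + φ_K(b₁)` must be a unique expression element in
`φ_K(A) + φ_K(B)`. … Since `φ_K({a₁, a₂} + {b₁, b₂})` is a unique expression element, it follows that
both elements in `φ_H({a₁, a₂} + {b₁, b₂})` have exactly two representations in `φ_H(A) + φ_H(B)` given
by (42) `φ_H(a₁) + φ_H(b₂) = φ_H(a₂) + φ_H(b₁)` and `φ_H(a₁) + φ_H(b₁) = φ_H(a₂) + φ_H(b₂)`.»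

In the tree's coordinates (`x = a₁, x′ = a₂, y = b₁, y′ = b₂`): the four sums take two values,
`x′ + y = x + y′` and `x′ + y′ = x + y` EXACTLY (each `H`-class of a `γᵢ` meets `A + B` in the single
element `γᵢ + h₀`, `H = {0, h₀}`), so `d := x′ − x = y′ − y` has `2d = 0`, `d ∉ H`: `H′ = {0, d}` and
`K = H ⊔ ⟨d⟩` with `g ∈ K ↔ g ∈ H ∨ g − d ∈ H`; `φ_K(γ₁)` (`= φ_K(γ₂)`) is uniquely expressed in
`φ_K(A) + φ_K(B)`; and (42) in the form «a pair `(u, v) ∈ A × B` with `u + v ≡ x + y (mod H)` is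
`≡ (x, y)` or `≡ (x′, y′)`», resp. for `x + y′`.

MAIN RESULTS (0 definitions, 0 named facts; everything PROVED): `Grynkiewicz2009.exists_generator_of_card_eq_two`,
`fourPairs_sums_eq`, `mem_sup_zmultiples_iff`, `fourPairs_uniqueExpression_modK`, `fourPairs_display42`.

## References
* D. J. Grynkiewicz, *A step beyond Kemperman's structure theorem*, Mathematika 55 (2009) 67–114,
  doi:10.1112/S0025579300000966, §6 Claim 5 (p. 25, case l = 4), display (42)
  [cite: Grynkiewicz2009, Thm 4.1 (proof, Claim 5)] — held `paper:doi-10-1112-s0025579300000966`,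
  p0025 read 2026-08-29.
-/

namespace Literature.Combinatorics.Additive

open Finset
open scoped Pointwise

universe u

variable {G : Type u} [AddCommGroup G] [DecidableEq G]

namespace Grynkiewicz2009

omit [DecidableEq G] in
/-- Membership transfer along an identity. [folklore] -/
private theorem memK {H : AddSubgroup G} {s t : G} (hs : s ∈ H) (e : t = s) : t ∈ H := by
  rw [e]; exact hs

/-- A subgroup of order two: `H = {0, h₀}` with `h₀ ≠ 0` (`H` carried as the finset `Hf`).
[cite: Grynkiewicz2009, §6 Claim 5 («|H| = 2»)] -/
theorem exists_generator_of_card_eq_two {Hf : Finset G} {H : AddSubgroup G}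
    (hHf : ∀ g, g ∈ Hf ↔ g ∈ H) (h2 : #Hf = 2) :
    ∃ h₀ : G, h₀ ≠ 0 ∧ h₀ ∈ H ∧ ∀ g, g ∈ H ↔ g = 0 ∨ g = h₀ := by
  obtain ⟨a, b, hab, hHab⟩ := card_eq_two.1 h2
  have h0 : (0 : G) ∈ Hf := (hHf 0).2 H.zero_mem
  rw [hHab, mem_insert, mem_singleton] at h0
  rcases h0 with h0 | h0
  · refine ⟨b, fun h => hab (by rw [← h0, h]), (hHf b).1 (by rw [hHab]; simp), fun g => ?_⟩
    rw [← hHf, hHab, mem_insert, mem_singleton, h0]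
  · refine ⟨a, fun h => hab (by rw [← h0, h]), (hHf a).1 (by rw [hHab]; simp), fun g => ?_⟩
    rw [← hHf, hHab, mem_insert, mem_singleton, h0, or_comm]

/-- **The four sums take two values.**  In the `l = 4` frame (`|H| = 2`, `γ₁, γ₂ ∉ A + B`,
`γ₁ ≢ γ₂ (mod H)`, all four pairs `{x, x′} × {y, y′} ⊆ A × B` relevant, `x ≢ x′`, `y ≢ y′`):
`x′ + y = x + y′` and `x′ + y′ = x + y` — each class `γᵢ + H = {γᵢ, γᵢ + h₀}` meets `A + B` only in
`γᵢ + h₀` («each `C_{γᵢ}` is a partially filled `H`-coset with `|H| = 2`»).  Consequently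
`d = x′ − x = y′ − y`, `2d = 0`, `d ∉ H` (the group `H′ = {0, d}` of the print).
[cite: Grynkiewicz2009, §6 Claim 5 (p. 25, case l = 4)] -/
theorem fourPairs_sums_eq {A B Hf : Finset G} {H : AddSubgroup G} {γ₁ γ₂ x y x' y' : G}
    (hHf : ∀ g, g ∈ Hf ↔ g ∈ H) (hHf2 : #Hf = 2) (hγ₁ : γ₁ ∉ A + B) (hγ₂ : γ₂ ∉ A + B)
    (hγ₁₂ : γ₁ - γ₂ ∉ H) (hx : x ∈ A) (hy : y ∈ B) (hx' : x' ∈ A) (hy' : y' ∈ B)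
    (hxx' : x - x' ∉ H) (hyy' : y - y' ∉ H)
    (hxy : x + y - γ₁ ∈ H ∨ x + y - γ₂ ∈ H) (hx'y' : x' + y' - γ₁ ∈ H ∨ x' + y' - γ₂ ∈ H)
    (hxy' : x + y' - γ₁ ∈ H ∨ x + y' - γ₂ ∈ H) (hx'y : x' + y - γ₁ ∈ H ∨ x' + y - γ₂ ∈ H) :
    x' + y = x + y' ∧ x' + y' = x + y ∧ x' - x = y' - y ∧ (x' - x) + (x' - x) = 0 ∧ x' - x ∉ H := by
  obtain ⟨h₀, hh₀0, hh₀H, hmem⟩ := exists_generator_of_card_eq_two hHf hHf2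
  -- a sum `≡ γ` equals `γ + h₀`
  have key : ∀ {u v γ : G}, u ∈ A → v ∈ B → γ ∉ A + B → u + v - γ ∈ H → u + v = γ + h₀ := by
    intro u v γ hu hv hγ h
    rcases (hmem _).1 h with h1 | h1
    · exact absurd (by rw [sub_eq_zero] at h1; rw [← h1]; exact add_mem_add hu hv) hγ
    · rw [← h1]; abel
  -- the value of a relevant sum determines its class
  have val : ∀ {u v : G}, u ∈ A → v ∈ B → (u + v - γ₁ ∈ H ∨ u + v - γ₂ ∈ H) →
      u + v = γ₁ + h₀ ∨ u + v = γ₂ + h₀ := fun hu hv h =>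
    h.imp (key hu hv hγ₁) (key hu hv hγ₂)
  have hne12 : γ₁ + h₀ ≠ γ₂ + h₀ := fun h => hγ₁₂ (memK H.zero_mem (by
    have := add_right_cancel h; rw [this, sub_self]))
  -- `x + y` and `x + y'` differ, so take both values; `x' + y`, `x' + y'` are then forced
  have h1 := val hx hy hxy
  have h2 := val hx hy' hxy'
  have h3 := val hx' hy hx'y
  have h4 := val hx' hy' hx'y'
  have hA : x + y ≠ x + y' := fun h => hyy' (memK H.zero_mem (by
    have := add_left_cancel h; rw [this, sub_self]))
  have hB : x + y ≠ x' + y := fun h => hxx' (memK H.zero_mem (by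
    have := add_right_cancel h; rw [this, sub_self]))
  have hC : x + y' ≠ x' + y' := fun h => hxx' (memK H.zero_mem (by
    have := add_right_cancel h; rw [this, sub_self]))
  have e1 : x' + y = x + y' := by
    rcases h1 with h1 | h1 <;> rcases h2 with h2 | h2 <;> rcases h3 with h3 | h3
    all_goals first
      | exact absurd (h1.trans h2.symm) hA
      | exact absurd (h1.trans h3.symm) hB
      | exact h3.trans h2.symm
  have e2 : x' + y' = x + y := by
    rcases h1 with h1 | h1 <;> rcases h2 with h2 | h2 <;> rcases h4 with h4 | h4
    all_goals first
      | exact absurd (h1.trans h2.symm) hA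
      | exact absurd (h2.trans h4.symm) hC
      | exact h4.trans h1.symm
  have e3 : x' - x = y' - y := by
    rw [← sub_eq_zero]; rw [← sub_eq_zero] at e1
    rw [← e1]; abel
  refine ⟨e1, e2, e3, ?_, fun h => hxx' (memK (H.neg_mem h) (by abel))⟩
  have : x' + y' - (x + y) = 0 := by rw [e2, sub_self]
  rw [← this]
  nth_rw 2 [e3]
  abel

omit [DecidableEq G] in
/-- The Klein group `K = H ⊔ ⟨d⟩` for `2d = 0`: `g ∈ K ↔ g ∈ H ∨ g − d ∈ H`.
[cite: Grynkiewicz2009, §6 Claim 5 («Let K = H × H′ ≅ ℤ/2ℤ × ℤ/2ℤ»)] -/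
theorem mem_sup_zmultiples_iff {H : AddSubgroup G} {d : G} (h2d : d + d = 0) (g : G) :
    g ∈ H ⊔ AddSubgroup.zmultiples d ↔ g ∈ H ∨ g - d ∈ H := by
  constructor
  · intro hg
    obtain ⟨h, hh, k, hk, rfl⟩ := AddSubgroup.mem_sup.1 hg
    obtain ⟨n, rfl⟩ := AddSubgroup.mem_zmultiples_iff.1 hk
    rcases Int.even_or_odd n with ⟨m, rfl⟩ | ⟨m, rfl⟩
    · left
      rw [add_zsmul, ← zsmul_add, h2d, zsmul_zero, add_zero]
      exact hh
    · right
      rw [add_zsmul, one_zsmul, show (2 * m) • d = m • (d + d) by rw [zsmul_add, two_mul, add_zsmul],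
        h2d, zsmul_zero, zero_add, add_sub_cancel_right]
      exact hh
  · rintro (hg | hg)
    · exact AddSubgroup.mem_sup_left hg
    · have : g = (g - d) + d := by abel
      rw [this]
      exact (H ⊔ AddSubgroup.zmultiples d).add_mem (AddSubgroup.mem_sup_left hg)
        (AddSubgroup.mem_sup_right (AddSubgroup.mem_zmultiples d))

/-- **`φ_K(γ₁)` is uniquely expressed in `φ_K(A) + φ_K(B)`** (`K = H ⊔ ⟨d⟩`, `d = x′ − x`): in the
`l = 4` frame (every relevant `a ≡ x, x′`, every relevant `b ≡ y, y′ (mod H)`), a pair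
`(u, v) ∈ A × B` with `u + v ≡ γ₁ (mod K)` has `u ≡ x` and `v ≡ y (mod K)`.  (Note `γ₂ ≡ γ₁ + d`, so
`φ_K(γ₂) = φ_K(γ₁)`.) [cite: Grynkiewicz2009, §6 Claim 5 (p. 25, «φ_K(γ₁) = φ_K(a₁) + φ_K(b₁) must be a
unique expression element in φ_K(A) + φ_K(B)»)] -/
theorem fourPairs_uniqueExpression_modK {A B Hf : Finset G} {H : AddSubgroup G}
    {γ₁ γ₂ x y x' y' : G} (hHf : ∀ g, g ∈ Hf ↔ g ∈ H) (hHf2 : #Hf = 2) (hγ₁ : γ₁ ∉ A + B)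
    (hγ₂ : γ₂ ∉ A + B) (hγ₁₂ : γ₁ - γ₂ ∉ H) (hx : x ∈ A) (hy : y ∈ B) (hx' : x' ∈ A) (hy' : y' ∈ B)
    (hxx' : x - x' ∉ H) (hyy' : y - y' ∉ H)
    (hxy : x + y - γ₁ ∈ H ∨ x + y - γ₂ ∈ H) (hx'y' : x' + y' - γ₁ ∈ H ∨ x' + y' - γ₂ ∈ H)
    (hxy' : x + y' - γ₁ ∈ H ∨ x + y' - γ₂ ∈ H) (hx'y : x' + y - γ₁ ∈ H ∨ x' + y - γ₂ ∈ H)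
    (hrelA : ∀ u ∈ A, ∀ v ∈ B, (u + v - γ₁ ∈ H ∨ u + v - γ₂ ∈ H) → u - x ∈ H ∨ u - x' ∈ H)
    (hrelB : ∀ u ∈ A, ∀ v ∈ B, (u + v - γ₁ ∈ H ∨ u + v - γ₂ ∈ H) → v - y ∈ H ∨ v - y' ∈ H)
    {u v : G} (hu : u ∈ A) (hv : v ∈ B)
    (huv : u + v - γ₁ ∈ H ⊔ AddSubgroup.zmultiples (x' - x)) :
    u - x ∈ H ⊔ AddSubgroup.zmultiples (x' - x) ∧ v - y ∈ H ⊔ AddSubgroup.zmultiples (x' - x) := by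
  obtain ⟨e1, -, e3, h2d, -⟩ :=
    fourPairs_sums_eq hHf hHf2 hγ₁ hγ₂ hγ₁₂ hx hy hx' hy' hxx' hyy' hxy hx'y' hxy' hx'y
  rw [mem_sup_zmultiples_iff h2d] at huv ⊢
  rw [mem_sup_zmultiples_iff h2d]
  -- `γ₂ ≡ γ₁ + d (mod H)`
  have hγd : γ₂ - γ₁ - (x' - x) ∈ H := by
    rcases hxy with h | h
    · have h' : x + y' - γ₂ ∈ H := hxy'.resolve_left fun h' => hyy' (memK (H.sub_mem h h') (by abel))
      exact memK (H.sub_mem h h') (by rw [e3]; abel)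
    · have h' : x + y' - γ₁ ∈ H := hxy'.resolve_right fun h' => hyy' (memK (H.sub_mem h h') (by abel))
      have h2d' : (y' - y) + (y' - y) = 0 := by rw [← e3]; exact h2d
      rw [e3, show γ₂ - γ₁ - (y' - y) = (-(x + y - γ₂) + (x + y' - γ₁)) - ((y' - y) + (y' - y)) by abel,
        h2d', sub_zero]
      exact H.add_mem (H.neg_mem h) h'
  -- in either case `(u, v)` is relevant
  have hrel : u + v - γ₁ ∈ H ∨ u + v - γ₂ ∈ H := by
    rcases huv with h | h
    · exact Or.inl h
    · exact Or.inr (memK (H.sub_mem h hγd) (by abel))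
  constructor
  · rcases hrelA u hu v hv hrel with h | h
    · exact Or.inl h
    · exact Or.inr (memK h (by abel))
  · rcases hrelB u hu v hv hrel with h | h
    · exact Or.inl h
    · exact Or.inr (memK h (by rw [e3]; abel))

omit [DecidableEq G] in
/-- **Display (42): exactly two representations modulo `H`.**  In the `l = 4` frame, a pair
`(u, v) ∈ A × B` with `u + v ≡ x + y (mod H)` is `≡ (x, y)` or `≡ (x′, y′)`, and one with
`u + v ≡ x + y′` is `≡ (x, y′)` or `≡ (x′, y)` («both elements in `φ_H({a₁, a₂} + {b₁, b₂})` have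
exactly two representations in `φ_H(A) + φ_H(B)` given by (42)»).
[cite: Grynkiewicz2009, §6 Claim 5, display (42)] -/
theorem fourPairs_display42 {A B : Finset G} {H : AddSubgroup G} {γ₁ γ₂ x y x' y' : G}
    (hxx' : x - x' ∉ H) (hyy' : y - y' ∉ H)
    (hxy : x + y - γ₁ ∈ H ∨ x + y - γ₂ ∈ H) (hxy' : x + y' - γ₁ ∈ H ∨ x + y' - γ₂ ∈ H)
    (hrelA : ∀ u ∈ A, ∀ v ∈ B, (u + v - γ₁ ∈ H ∨ u + v - γ₂ ∈ H) → u - x ∈ H ∨ u - x' ∈ H)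
    (hrelB : ∀ u ∈ A, ∀ v ∈ B, (u + v - γ₁ ∈ H ∨ u + v - γ₂ ∈ H) → v - y ∈ H ∨ v - y' ∈ H)
    {u v : G} (hu : u ∈ A) (hv : v ∈ B) :
    (u + v - (x + y) ∈ H → (u - x ∈ H ∧ v - y ∈ H) ∨ (u - x' ∈ H ∧ v - y' ∈ H)) ∧
    (u + v - (x + y') ∈ H → (u - x ∈ H ∧ v - y' ∈ H) ∨ (u - x' ∈ H ∧ v - y ∈ H)) := by
  constructor
  · intro h
    have hrel : u + v - γ₁ ∈ H ∨ u + v - γ₂ ∈ H :=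
      hxy.imp (fun h' => memK (H.add_mem h h') (by abel)) (fun h' => memK (H.add_mem h h') (by abel))
    rcases hrelA u hu v hv hrel with ha | ha <;> rcases hrelB u hu v hv hrel with hb | hb
    · exact Or.inl ⟨ha, hb⟩
    · exact absurd (memK (H.neg_mem (H.sub_mem (H.sub_mem h ha) hb)) (by abel)) hyy'
    · exact absurd (memK (H.sub_mem (H.sub_mem ha h) (H.neg_mem hb)) (by abel)) hxx'
    · exact Or.inr ⟨ha, hb⟩
  · intro h
    have hrel : u + v - γ₁ ∈ H ∨ u + v - γ₂ ∈ H :=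
      hxy'.imp (fun h' => memK (H.add_mem h h') (by abel)) (fun h' => memK (H.add_mem h h') (by abel))
    rcases hrelA u hu v hv hrel with ha | ha <;> rcases hrelB u hu v hv hrel with hb | hb
    · exact absurd (memK (H.sub_mem (H.sub_mem h ha) hb) (by abel)) hyy'
    · exact Or.inl ⟨ha, hb⟩
    · exact Or.inr ⟨ha, hb⟩
    · exact absurd (memK (H.neg_mem (H.sub_mem (H.sub_mem h ha) hb)) (by abel)) hxx'

end Grynkiewicz2009

end Literature.Combinatorics.Additive
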